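import Literature.Computability.Complexity.SameLengthCheckerMachine
import Literature.Computability.Complexity.IWBootstrapping
import Literature.Computability.Complexity.ReductionsProofs
import Literature.Computability.Complexity.PSpaceClosure
import HarnessLib

/-!
# Murray–Williams' Theorem 2.2 (SIAM Thm. 2.7, after Santhanam): the padded language
# `{1ⁱ 0 x : x ∈ S}` — paddability, hardness, downward self-reducibility and SAME-LENGTH
# checkability from a downward self-reducible, downward-checkable `S`

Literature / circuit complexity. Murray–Williams' Theorem 2.2 (C. D. Murray, R. R. Williams, STOC
2018; SIAM J. Comput. 49 (2020), Thm. 2.7, pp. STOC18-308/309) asserts a `PSPACE`-complete language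
`L_PSPACE` that is paddable, downward self-reducible and checkable by a probabilistic polynomial-time
oracle machine asking queries ONLY OF THE INPUT'S LENGTH. Its printed proof is a padding step over a
structured language `S` (there: Trevisan–Vadhan's, Comput. Complexity 16 (2007), §4, with the checker
of Santhanam, SIAM J. Comput. 39 (2009), Lemma 12): "Let `L_PSPACE = {1ⁱ 0 x | x ∈ S}` … for every
length of padding `m ≥ 0`, `1ᵐ x ∈ L_PSPACE ⟺ x ∈ L_PSPACE`, and thus `L_PSPACE` is paddable. To
construct a downward self-reduction `A` … `A`: On input `y`, parse `y = 1ᵐ 0 x`. If `m > 0`, accept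
iff `1^{m-1} 0 x ∈ L_PSPACE`. If `m = 0`, run the downward self-reduction `A₀` on `x`. For every query
`x'` for `S` made by `A₀`, query `0x'` instead … Since `x` has length `|y| - 1`, all of the queries
`x'` made by `A₀` are of length `|y| - 2`, so `0x'` is a query of length `|y| - 1`" (SIAM p.
STOC18-309); the same re-padding `x' ↦ 1…1 0 x'` turns a checker of `S` whose queries are NOT LONGER
than its input into a checker of `L_PSPACE` with queries of exactly the input's length.

This file carries out that step GENERICALLY in `S`, landing in the structures the tree's rendering
of Thm. 2.2 consists of (`MurrayWilliams2018_NQP_not_subset_ACC0_of_thm_2_2_language`,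
`MurrayWilliams2018HeadlineFromThm22.lean`: `IsHard PSPACE`, `hpad`, `hones`, `AlmostAE.DSR`,
`AlmostAE.SameLengthChecker`):

* `onesZeroPad S = {1ⁱ 0 x : x ∈ S}` with `OnesZeroPad.true_cons_mem_iff` (paddability),
  `OnesZeroPad.replicate_not_mem` (no all-ones words — the SIAM text also puts `{1ⁱ}` into
  `L_PSPACE`; the tree's Thm. 2.2 clauses exclude them, which changes nothing else),
  `OnesZeroPad.karpReducible : S ≤ₚ onesZeroPad S` (`x ↦ 0x`) and **`OnesZeroPad.isHard`**
  (hardness for any class transfers, `IsHard.of_reducible_holds`); `OnesZeroPad.mem_PSPACE`,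
  **`OnesZeroPad.isComplete`** (membership, hence `PSPACE`-completeness, transfers too: the padded
  language is the `P`-set of words with a `0` cut down by the `FP`-preimage of `S` under the payload
  map, `PSpaceClosure.lean`);
* **`AlmostAE.DSR.ofOnesZeroPad`** — MW's reduction `A` as a polynomial-time language on pairs
  `⟨z, d⟩` (`OnesZeroPad.DSRM.dsrFn`: branch on the head bit; the `FP` emulation `OracleAlg.simFn`
  of `A₀` on the payload with every query `x'` answered by the description `d` at
  `padTo (|z|-1) x' = 1…1 0 x'`, `OracleSimulateFP.lean`; the query cap is that of `A₀` against
  one-bit oracles, `OracleAlg.IsPolyTime.exists_queryBound`), CORRECT against every description of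
  the previous slice (`DSRM.correct`), from a downward self-reduction `A₀` of `S` in the machine form
  of Impagliazzo–Wigderson's Def. 6 / MW Def. 2.5 (the hypothesis `hDSR` of
  `IWUniform.mem_BPP_of_dsr_of_stronglyConstructible`, `IWBootstrapping.lean`: within `bA |x|` rounds
  `A₀` outputs `[x ∈ S]` against EVERY oracle answering `S` on the queries shorter than `x`);
* **`AlmostAE.SameLengthChecker.ofOnesZeroPad`** — the same-length checker of the padded language
  (`OnesZeroPad.ChkM.chkFn`: reject all-ones inputs; run the clocked, coin-cut checker
  `SLChecker.chk M` of `SameLengthCheckerMachine.lean` on the payload, answering each query `x'` by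
  `d` at `padTo |z| x'`), COMPLETE with probability `1` behind every description of the slice at the
  input's length (`ChkM.complete`) and `1/3`-SOUND against every description (`ChkM.sound`: the coin
  prefix of length `coins(|x|)` is uniform, `uniformProb_take_of_le`), from a probabilistic
  polynomial-time oracle machine `M` checking `S` DOWNWARD: complete with probability `1` against
  every oracle answering `S` on the queries of length `≤ |x|`, `1/3`-sound against every one-bit
  oracle (`OnesZeroPad.hcomp_of_queryLength` / `hdsr_of_queryLength` derive these semantic forms
  from the printed syntactic query-length clauses);
* **`MurrayWilliams2018_thm_2_2_language_of_downwardCheckable`** (the five clauses, existentially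
  packaged), **`MurrayWilliams2018_NQP_not_subset_ACC0_of_downwardCheckable`** (the headline from a
  `PSPACE`-hard `S` with such `A₀`, `M` — nothing else) and
  **`MurrayWilliams2018_lemma_4_1_ae_of_downwardCheckable_of_umansGenerator`** (Lemma 4.1, a.e. form,
  from the same data and a generator of Umans' type, `UmansGenerator`);
* the same from a downward checker in DESCRIPTION FORM — **`DownwardCheckerFn S`**: a string function
  `chk acc` on `⟨⟨x, r⟩, e⟩` parametrized by an oracle-ACCESS BRICK `acc` (query `q` answered by
  `acc ⟨q, e⟩`), in `FP` uniformly in `acc`, perfectly complete behind every access brick answering `S`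
  on the queries not longer than `x`, `1/3`-sound whatever `acc`, `e` (the form in which Arthur uses
  the machine: Merlin's circuit answers the queries; the intended supplier is the checker of
  Trevisan–Vadhan's language of the sequel files `TVChecker*.lean`) — `OnesZeroPad.ChkF.*`,
  **`AlmostAE.SameLengthChecker.ofDownwardFn`** (access brick `accF`: the description at the re-padded
  query `1…1 0 x'`), `MurrayWilliams2018_thm_2_2_language_of_downwardFn`,
  **`MurrayWilliams2018_NQP_not_subset_ACC0_of_downwardFn`**,
  `MurrayWilliams2018_lemma_4_1_ae_of_downwardFn_of_umansGenerator`.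

So, as of this file, the language of Thm. 2.2 — hence the headline `NQP ⊄ ACC⁰` — needs from
Trevisan–Vadhan's construction (`TVFunction.lean`, `TVSelfCorrect.lean`, …: `LTV`) exactly:
`PSPACE`-hardness, the downward self-reduction machine (IW Def. 6 form) and a downward checker
machine; and `MurrayWilliams2018_lemma_4_1_ae` needs in addition only Umans' generator (Thm. 2.1).
Note for the supplier of the downward checker (numbers from `TVFunction.lean` /
`QBFUniversal.lean`, not used in this file): an LFKN-type checker descending the chain
`f_{n,i} → f_{n,i+1}` one random field point per stage errs, against a fixed wrong oracle, with
probability `≤ δᵢ/|K|` at a stage whose axis restriction has degree `≤ δᵢ`; with the uniform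
per-variable bound `δ = max 3 (2n)` (`degreeOf_fam_le`) the union bound `mlen n · δ / |K n|`
exceeds `1` at `TVFunction.lean`'s field (`|K n| ≤ 2 (Dn n + 1)`), so the analysis must use the
schedule's stage-by-stage degrees and the product form `1 - ∏ᵢ (1 - δᵢ/|K|)` of the soundness error,
followed by independent repetitions (`DownwardChainChecker.lean` and its sequel); the hypotheses
`hcomp`/`hsound` below are stated for whatever machine achieves them.

Definitions with bodies and theorems only; no named fact is introduced (D-0026). Mathlib has no
oracle machines or interactive proofs; nothing here duplicates the tree (searched `onesZeroPad`,
`1ⁱ 0 x`, `thm_2_7`, `Santhanam`, `ofOnesZeroPad`, 2026-08-15).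

## References

* C. D. Murray, R. R. Williams, *Circuit lower bounds for nondeterministic quasi-polytime: an easy
  witness lemma for NP and NQP*, STOC 2018, 890–901; SIAM J. Comput. 49 (2020), Def. 2.5, Def. 2.6,
  Thm. 2.7 and its proof (pp. STOC18-308/309 of the held text `paper:doi-10-1137-18m1195887`)
  [MurrayWilliams2018].
* R. Santhanam, *Circuit lower bounds for Merlin–Arthur classes*, SIAM J. Comput. 39 (2009)
  1038–1061, Lemma 12 (held text `paper:doi-10-1137-070702680`, p. 6: "a PSPACE-complete language
  with function-restricted interactive proofs where the prover only answers questions of the same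
  length as the input").
* L. Trevisan, S. Vadhan, *Pseudorandomness and average-case complexity via uniform reductions*,
  Comput. Complexity 16 (2007), §4 [TrevisanVadhan2007].
* R. Impagliazzo, A. Wigderson, *Randomness vs time: derandomization under a uniform assumption*,
  JCSS 63 (2001), Def. 6 (downward self-reducibility) [ImpagliazzoWigderson2001].
* S. Arora, B. Barak, *Computational Complexity: A Modern Approach*, CUP 2009, §3.4 (oracle
  machines), §7.1, Thm. 6.18 [AroraBarakCC2009].
-/

noncomputable section

namespace Literature.Computability.Complexity

open _root_.Computability Polynomial Brick CircEval CodeFP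
open Literature.Computability.Cryptography (OracleAdversary)
open scoped Notation

/-! ### The padded language -/

/-- **Santhanam's padding** of a language `S`: `onesZeroPad S = {1ⁱ 0 x : i ≥ 0, x ∈ S}`
(Murray–Williams, proof of SIAM Thm. 2.7: "`L_PSPACE = {1ⁱ 0 x | x ∈ S and i ≥ 0}`, where `S` is
the `PSPACE`-complete language of Trevisan and Vadhan"; the all-ones words, which the SIAM text
also puts into `L_PSPACE`, are left out, as in the tree's rendering of Thm. 2.2 — `hones` of
`MurrayWilliams2018_NQP_not_subset_ACC0_of_thm_2_2_language`).
[cite: MurrayWilliams2018, Thm. 2.2 (SIAM J. Comput. 49, Thm. 2.7, proof)] -/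
def onesZeroPad (S : Language Bool) : Language Bool :=
  {z | ∃ (i : ℕ) (x : List Bool), z = List.replicate i true ++ false :: x ∧ x ∈ S}

namespace OnesZeroPad

variable {S : Language Bool}

/-- `1ⁱ 0 x ∈ onesZeroPad S ↔ x ∈ S`. [cite: MurrayWilliams2018, Thm. 2.2 (SIAM Thm. 2.7, proof)] -/
theorem replicate_append_mem_iff (i : ℕ) (x : List Bool) :
    List.replicate i true ++ false :: x ∈ onesZeroPad S ↔ x ∈ S := by
  constructor
  · rintro ⟨j, y, h, hy⟩
    have h' := congrArg MWProtocol.stripOnes h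
    rw [MWProtocol.stripOnes_replicate_append, MWProtocol.stripOnes_replicate_append] at h'
    cases h'
    exact hy
  · exact fun hx => ⟨i, x, rfl, hx⟩

/-- `0 x ∈ onesZeroPad S ↔ x ∈ S`. [cite: MurrayWilliams2018, Thm. 2.2 (SIAM Thm. 2.7, proof)] -/
theorem false_cons_mem_iff (x : List Bool) : false :: x ∈ onesZeroPad S ↔ x ∈ S :=
  replicate_append_mem_iff 0 x

/-- **Paddability** (MW Def. 2.6 / the clause `hpad`): `1 z ∈ onesZeroPad S ↔ z ∈ onesZeroPad S`
("by definition, it is clear that for every length of padding `m ≥ 0`, `1ᵐ x ∈ L_PSPACE ⟺ x ∈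
L_PSPACE`"). [cite: MurrayWilliams2018, Thm. 2.2 (SIAM Thm. 2.7, proof: paddability)] -/
theorem true_cons_mem_iff (z : List Bool) : true :: z ∈ onesZeroPad S ↔ z ∈ onesZeroPad S := by
  constructor
  · rintro ⟨i, x, h, hx⟩
    cases i with
    | zero => simp at h
    | succ i =>
      rw [List.replicate_succ, List.cons_append] at h
      exact ⟨i, x, (List.cons.inj h).2, hx⟩
  · rintro ⟨i, x, rfl, hx⟩
    exact ⟨i + 1, x, rfl, hx⟩

/-- Iterated paddability: `1ᵐ z ∈ onesZeroPad S ↔ z ∈ onesZeroPad S`.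
[cite: MurrayWilliams2018, Def. 2.6 (SIAM)] -/
theorem replicate_append_mem_iff' (m : ℕ) (z : List Bool) :
    List.replicate m true ++ z ∈ onesZeroPad S ↔ z ∈ onesZeroPad S := by
  induction m with
  | zero => rfl
  | succ m ih => rw [List.replicate_succ, List.cons_append, true_cons_mem_iff, ih]

/-- **No all-ones words** (the clause `hones`): `1ᵇ ∉ onesZeroPad S`.
[cite: MurrayWilliams2018, Thm. 2.2 (SIAM Thm. 2.7, proof)] -/
theorem replicate_not_mem (b : ℕ) : List.replicate b true ∉ onesZeroPad S := by
  rintro ⟨i, x, h, -⟩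
  have h' := congrArg MWProtocol.stripOnes h
  rw [MWProtocol.stripOnes_replicate, MWProtocol.stripOnes_replicate_append] at h'
  exact List.cons_ne_nil _ _ h'.symm

/-- Membership through the parse `stripOnes` (`MurrayWilliams2018Protocol.lean`): `z ∈ onesZeroPad S`
iff stripping the leading `1`s leaves `0 x` with `x ∈ S`. [cite: MurrayWilliams2018, Thm. 2.2 (SIAM Thm. 2.7, proof: "parse y = 1ᵐ0x")] -/
theorem mem_iff_stripOnes (z : List Bool) :
    z ∈ onesZeroPad S ↔ ∃ x, MWProtocol.stripOnes z = false :: x ∧ x ∈ S := by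
  rcases MWProtocol.eq_replicate_or_exists z with ⟨hz, hs⟩ | ⟨a, x, hz, hs⟩
  · rw [hs]
    constructor
    · intro h
      rw [hz] at h
      exact absurd h (replicate_not_mem _)
    · rintro ⟨x, hx, -⟩
      exact absurd hx (by simp)
  · rw [hs, hz, replicate_append_mem_iff]
    constructor
    · exact fun h => ⟨x, rfl, h⟩
    · rintro ⟨x', hx', h'⟩
      cases hx'
      exact h'

/-! ### Hardness transfer -/

/-- `S` Karp-reduces to its padding by `x ↦ 0 x`.
[cite: MurrayWilliams2018, Thm. 2.2 (SIAM Thm. 2.7: "L_PSPACE is PSPACE-complete")] -/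
theorem karpReducible (S : Language Bool) : S ≤ₚ onesZeroPad S :=
  ⟨List.cons false, cons_mem_FP false, fun x => (false_cons_mem_iff x).symm⟩

/-- **Hardness transfers to the padding** (for any class `C`, in particular `PSPACE`).
[cite: MurrayWilliams2018, Thm. 2.2 (SIAM Thm. 2.7: "L_PSPACE is PSPACE-complete")] -/
theorem isHard {C : Set (Language Bool)} (h : IsHard C S) : IsHard C (onesZeroPad S) :=
  IsHard.of_reducible_holds h (karpReducible S)

/-! ### Membership transfer: the padding of a `PSPACE` language is in `PSPACE` -/

/-- The payload map `z ↦ (stripOnes z) ⇂ 1` (`1ⁱ 0 x ↦ x`) is in `FP`. [folklore] -/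
theorem payload_mem_FP : (fun z => (MWProtocol.stripOnes z).drop 1) ∈ FP := by
  obtain ⟨f, hf, hfg⟩ := (strDrop.comp ((CodeFP.const strE (eβ := unE) 1).pair MWProtocol.stripOnesC))
  have : f = fun z => (MWProtocol.stripOnes z).drop 1 := funext hfg
  exact this ▸ hf

/-- The words with a `0` (`stripOnes z ≠ ε`) form a language in `P`. [folklore] -/
theorem hasZero_mem_P : ({z : List Bool | MWProtocol.stripOnes z ≠ []} : Language Bool) ∈ Classes.P := by
  obtain ⟨f, hf, hfg⟩ := (CodeFP.eq (eα := strE) Function.injective_id).comp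
    (MWProtocol.stripOnesC.pair (CodeFP.const strE (eβ := strE) ([] : List Bool)))
  have hfz : ∀ z : List Bool, f z = [decide (MWProtocol.stripOnes z = [])] := fun z => hfg z
  have hset : ({z : List Bool | MWProtocol.stripOnes z ≠ []} : Language Bool) = {z | f z = [false]} := by
    ext z
    simp only [Set.mem_setOf_eq, hfz, List.cons.injEq, and_true, decide_eq_false_iff_not]
  rw [hset]
  exact setOf_apply_eq_apply_mem_P hf (const_mem_FP [false])

/-- The padded language is the `P`-set of words with a `0` cut down by the preimage of `S` under the
payload map. [cite: MurrayWilliams2018, Thm. 2.2 (SIAM Thm. 2.7, proof: "parse y = 1ᵐ0x")] -/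
theorem eq_inter_preimage (S : Language Bool) :
    onesZeroPad S = ({z : List Bool | MWProtocol.stripOnes z ≠ []} : Language Bool) ⊓
      ((fun z => (MWProtocol.stripOnes z).drop 1) ⁻¹' S : Language Bool) := by
  ext z
  rw [mem_iff_stripOnes]
  change _ ↔ MWProtocol.stripOnes z ≠ [] ∧ (MWProtocol.stripOnes z).drop 1 ∈ S
  rcases MWProtocol.eq_replicate_or_exists z with ⟨-, hs⟩ | ⟨a, x, -, hs⟩
  · rw [hs]; simp
  · rw [hs]
    simp only [List.cons.injEq, true_and, exists_eq_left', ne_eq, reduceCtorEq, not_false_eq_true,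
      List.drop_succ_cons, List.drop_zero]

/-- **Membership transfers to the padding**: `S ∈ PSPACE ⟹ onesZeroPad S ∈ PSPACE`
(`PSpaceClosure.lean`: preimages under `FP` maps and intersections with `P`).
[cite: MurrayWilliams2018, Thm. 2.2 (SIAM Thm. 2.7: "L_PSPACE is PSPACE-complete")] -/
theorem mem_PSPACE (h : S ∈ PSPACE) : onesZeroPad S ∈ PSPACE := by
  rw [eq_inter_preimage]
  exact inter_P_mem_PSPACE hasZero_mem_P (preimage_mem_PSPACE h payload_mem_FP)

/-- **`PSPACE`-completeness transfers to the padding.**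
[cite: MurrayWilliams2018, Thm. 2.2 (SIAM Thm. 2.7: "L_PSPACE is PSPACE-complete")] -/
theorem isComplete (h : IsComplete PSPACE S) : IsComplete PSPACE (onesZeroPad S) :=
  ⟨mem_PSPACE h.mem, isHard h.isHard⟩

/-! ### Padding a query up to a prescribed length -/

/-- `padTo n q = 1^{n-|q|-1} 0 q`: the query `q` about `S` re-asked as a query about the padded
language, of length exactly `n` when `|q| < n` (MW: "for every query `x'` … query `0x'` instead";
Santhanam: pad shorter queries up to the input length). [cite: MurrayWilliams2018, Thm. 2.2 (SIAM Thm. 2.7, proof)] -/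
def padTo (n : ℕ) (q : List Bool) : List Bool :=
  List.replicate (n - (q.length + 1)) true ++ false :: q

/-- The padded query has length `n` as soon as `|q| < n`. [folklore] -/
theorem length_padTo {n : ℕ} {q : List Bool} (h : q.length < n) : (padTo n q).length = n := by
  simp only [padTo, List.length_append, List.length_replicate, List.length_cons]
  omega

/-- The padded query asks `q ∈ S`. [cite: MurrayWilliams2018, Thm. 2.2 (SIAM Thm. 2.7, proof)] -/
theorem padTo_mem_iff (n : ℕ) (q : List Bool) : padTo n q ∈ onesZeroPad S ↔ q ∈ S :=
  replicate_append_mem_iff _ _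

/-- The `FP` realization of `padTo`: `(1ⁿ ⇂ (|q|+1)) ++ ([0] ++ q)`. [folklore] -/
theorem padTo_eq_drop (n : ℕ) (q : List Bool) :
    padTo n q = (List.replicate n true).drop (q.length + 1) ++ ([false] ++ q) := by
  rw [padTo, List.drop_replicate, List.singleton_append]

/-! ### Small helpers -/

/-- For strings coding themselves, "computed on codes" is membership in `FP`. [folklore] -/
theorem codeFP_strE_iff {g : List Bool → List Bool} : CodeFP strE strE g ↔ g ∈ FP := by
  constructor
  · rintro ⟨f, hf, hfg⟩
    have : f = g := funext hfg
    exact this ▸ hf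
  · exact fun hg => ⟨g, hg, fun _ => rfl⟩

/-- A bit-valued map computed on codes, as the one-symbol string map, is in `FP`. [folklore] -/
theorem mem_FP_of_codeFP_bit {p : List Bool → Bool} (h : CodeFP strE bitE p) : (fun w => [p w]) ∈ FP := by
  obtain ⟨f, hf, hfg⟩ := h
  have : f = fun w => [p w] := funext hfg
  exact this ▸ hf

/-- Oracles of languages agreeing at a word answer it alike. [folklore] -/
theorem ofLanguage_congr {A B : Language Bool} {y : List Bool} (h : y ∈ A ↔ y ∈ B) :
    Oracle.ofLanguage A y = Oracle.ofLanguage B y := by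
  rw [Oracle.ofLanguage_apply, Oracle.ofLanguage_apply]
  by_cases hy : y ∈ A
  · rw [(Set.mem_iff_boolIndicator _ _).1 hy, (Set.mem_iff_boolIndicator _ _).1 (h.1 hy)]
  · rw [(Set.notMem_iff_boolIndicator _ _).1 hy,
      (Set.notMem_iff_boolIndicator _ _).1 fun hB => hy (h.2 hB)]

/-- The oracle presented by a description `d` behind the padding map `padTo n`: the one-bit oracle
of the language `{q | padTo n q ∈ descLang d}`. [folklore] -/
def padOracleLang (n : ℕ) (d : List Bool) : Language Bool := {q | padTo n q ∈ SLChecker.descLang d}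

/-- `evalFn ⟨padTo n q, d⟩` is the one-bit oracle of `padOracleLang n d`. [folklore] -/
theorem evalFn_padTo (n : ℕ) (d q : List Bool) :
    evalFn (boolPair (padTo n q) d) = Oracle.ofLanguage (padOracleLang n d) q := by
  rw [SLChecker.evalFn_eq_ofLanguage]
  rfl

/-- Behind a description of the slice of the padded language at length `n`, short queries are
answered by `S`. [cite: MurrayWilliams2018, Thm. 2.2 (SIAM Thm. 2.7, proof)] -/
theorem mem_padOracleLang_iff {n : ℕ} {d : List Bool} (hd : AlmostAE.DescribesSlice (onesZeroPad S) n d)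
    {q : List Bool} (hq : q.length < n) : q ∈ padOracleLang n d ↔ q ∈ S := by
  change padTo n q ∈ SLChecker.descLang d ↔ q ∈ S
  rw [SLChecker.mem_descLang_iff_of_describesSlice hd (length_padTo hq), padTo_mem_iff]

/-! ### Downward self-reducibility of the padded language (MW's reduction `A`) -/

namespace DSRM

variable (A₀ : OracleAlg (List Bool)) (bA c : Polynomial ℕ)

/-- The input handed to `A₀`: the payload `x` of `z = 0 x` (`z = fst w`). [cite: MurrayWilliams2018, Thm. 2.2 (SIAM Thm. 2.7, proof: "If m = 0, run A₀ on x")] -/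
def preD : List Bool → List Bool := fun w => (fstF w).drop 1

/-- The answer rule: on the record `u = ⟨w, q⟩`, `w = ⟨z, d⟩`, the query `q` of `A₀` is answered by
the description at the padded query of length `|z| - 1`: `evalFn ⟨padTo (|z|-1) q, d⟩`.
[cite: MurrayWilliams2018, Thm. 2.2 (SIAM Thm. 2.7, proof: "query 0x' instead")] -/
def ansD : List Bool → List Bool := fun u =>
  evalFn (boolPair (padTo ((fstF (fstF u)).length - 1) (sndF u)) (sndF (fstF u)))

/-- The emulation of `A₀` on the payload with the re-padded queries (queries capped at
`c(|w| + bA |w|)`, `bA |w|` rounds). [cite: MurrayWilliams2018, Thm. 2.2 (SIAM Thm. 2.7, proof)] -/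
def emuD : List Bool → List Bool := OracleAlg.simFn A₀ preD ansD (c.comp (X + bA)) bA

/-- The head bit of `z`. [folklore] -/
def headD : List Bool → List Bool := HashBricks.headBitFn ∘ fstF

/-- The branch `m > 0`: ask the description about `z` with one leading `1` removed.
[cite: MurrayWilliams2018, Thm. 2.2 (SIAM Thm. 2.7, proof: "If m > 0, accept iff 1^{m-1}0x ∈ L")] -/
def tailEval : List Bool → List Bool := fun w => evalFn (boolPair ((fstF w).drop 1) (sndF w))

/-- **MW's downward self-reduction `A` of the padded language**, run against the description in its
input: on `w = ⟨z, d⟩`, if `z = 1 z'` answer `d(z')`, else (`z = 0 x`) run `A₀` on `x` answering each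
query `x'` by `d(1…1 0 x')`. [cite: MurrayWilliams2018, Thm. 2.2 (SIAM Thm. 2.7, proof: the reduction A)] -/
def dsrFn : List Bool → List Bool := iteFn headD tailEval (emuD A₀ bA c)

/-- Its language. [cite: MurrayWilliams2018, Thm. 2.2 (SIAM Thm. 2.7, proof)] -/
def lang : Language Bool := {w | dsrFn A₀ bA c w = [true]}

/-! #### Polynomial time -/

/-- `preD ∈ FP`. [folklore] -/
theorem preD_mem_FP : preD ∈ FP :=
  codeFP_strE_iff.1 ((strDrop.comp ((CodeFP.const strE (eβ := unE) 1).pair MWProtocol.fstC)).congr fun _ => rfl)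

/-- The re-padded query as a string map on `u = ⟨⟨z, d⟩, q⟩`, computed on codes. [folklore] -/
theorem padQueryC : CodeFP strE strE (fun u => padTo ((fstF (fstF u)).length - 1) (sndF u)) := by
  refine (strAppend.comp ((strDrop.comp ((unSucc.comp (strLength.comp MWProtocol.sndC)).pair
    (strDrop.comp ((CodeFP.const strE (eβ := unE) 1).pair
      (strOfUn.comp (strLength.comp (MWProtocol.fstC.comp MWProtocol.fstC))))))).pair
    (strAppend.comp ((CodeFP.const strE (eβ := strE) [false]).pair MWProtocol.sndC)))).congr fun u => ?_
  dsimp only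
  rw [padTo_eq_drop, unE_eq_ones]
  change ((List.replicate (fstF (fstF u)).length true).drop 1).drop ((sndF u).length + 1) ++ ([false] ++ sndF u) = _
  rw [List.drop_replicate]

/-- `ansD ∈ FP`. [folklore] -/
theorem ansD_mem_FP : ansD ∈ FP :=
  comp_mem_FP evalFn_mem_FP (codeFP_strE_iff.1
    ((MWProtocol.strPairC.comp (padQueryC.pair (MWProtocol.sndC.comp MWProtocol.fstC))).congr fun _ => rfl))

/-- `emuD ∈ FP` for polynomial-time `A₀`. [cite: AroraBarakCC2009, §3.4 (emulating an oracle machine)] -/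
theorem emuD_mem_FP (hA₀ : A₀.IsPolyTime (encodingList Bool)) : emuD A₀ bA c ∈ FP :=
  OracleAlg.simFn_mem_FP hA₀ preD_mem_FP ansD_mem_FP _ _

/-- `headD ∈ FP`. [folklore] -/
theorem headD_mem_FP : headD ∈ FP := comp_mem_FP HashBricks.headBitFn_mem_FP fstF_mem_FP

/-- `tailEval ∈ FP`. [folklore] -/
theorem tailEval_mem_FP : tailEval ∈ FP :=
  comp_mem_FP evalFn_mem_FP (codeFP_strE_iff.1 ((MWProtocol.strPairC.comp
    ((strDrop.comp ((CodeFP.const strE (eβ := unE) 1).pair MWProtocol.fstC)).pair MWProtocol.sndC)).congr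
      fun _ => rfl))

/-- **`dsrFn ∈ FP`.** [cite: MurrayWilliams2018, Thm. 2.2 (SIAM Thm. 2.7: A is polynomial time)] -/
theorem dsrFn_mem_FP (hA₀ : A₀.IsPolyTime (encodingList Bool)) : dsrFn A₀ bA c ∈ FP :=
  iteFn_mem_FP headD_mem_FP tailEval_mem_FP (emuD_mem_FP A₀ bA c hA₀)

/-- **`lang ∈ P`.** [cite: MurrayWilliams2018, Thm. 2.2 (SIAM Thm. 2.7: A is polynomial time)] -/
theorem lang_mem_P (hA₀ : A₀.IsPolyTime (encodingList Bool)) : lang A₀ bA c ∈ Classes.P :=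
  setOf_apply_eq_apply_mem_P (dsrFn_mem_FP A₀ bA c hA₀) (const_mem_FP [true])

/-! #### Semantics -/

/-- On `⟨1 z', d⟩` the reduction asks `d` about `z'`. [cite: MurrayWilliams2018, Thm. 2.2 (SIAM Thm. 2.7, proof)] -/
theorem dsrFn_true_cons (z' d : List Bool) :
    dsrFn A₀ bA c (boolPair (true :: z') d) = evalFn (boolPair z' d) := by
  unfold dsrFn
  rw [iteFn_apply_true (by simp [headD])]
  simp [tailEval]

/-- On `⟨0 x, d⟩` the reduction emulates `A₀`. [cite: MurrayWilliams2018, Thm. 2.2 (SIAM Thm. 2.7, proof)] -/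
theorem dsrFn_false_cons (x d : List Bool) :
    dsrFn A₀ bA c (boolPair (false :: x) d) = emuD A₀ bA c (boolPair (false :: x) d) := by
  unfold dsrFn
  rw [iteFn_apply_false (by simp [headD])]

/-- The oracle the emulation presents to `A₀` on `⟨0 x, d⟩`: `padOracleLang |x| d`. [folklore] -/
theorem ansD_record (x d : List Bool) :
    (fun q => ansD (boolPair (boolPair (false :: x) d) q)) = Oracle.ofLanguage (padOracleLang x.length d) := by
  funext q
  simp only [ansD, fstF_boolPair, sndF_boolPair, List.length_cons, Nat.add_sub_cancel]
  exact evalFn_padTo _ _ _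

variable {A₀ bA c}

/-- **Semantics of the emulation**: if `A₀` is a downward self-reduction of `S` (IW Def. 6 / MW
Def. 2.5: against every oracle answering `S` on the queries shorter than `x` it outputs `[x ∈ S]`
within `bA |x|` rounds), its queries against one-bit oracles are capped by `c`, and `d` describes the
slice of the padded language at length `|x|`, then on `⟨0 x, d⟩` the emulation returns `[x ∈ S]`.
[cite: MurrayWilliams2018, Thm. 2.2 (SIAM Thm. 2.7, proof: "all of the queries x' made by A₀ are of length |y| - 2, so 0x' is a query of length |y| - 1")] -/
theorem emuD_false_cons
    (hdsr : ∀ (x : List Bool) (O : Oracle), (∀ y : List Bool, y.length < x.length → O y = Oracle.ofLanguage S y) →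
      A₀.run O (bA.eval x.length) x = some (Oracle.ofLanguage S x))
    (hc : ∀ O : Oracle, (∀ q, (O q).length ≤ 1) → ∀ (k : ℕ) (x : List Bool),
      ∀ q ∈ A₀.queries O k x, q.length ≤ c.eval (x.length + k))
    {x d : List Bool} (hd : AlmostAE.DescribesSlice (onesZeroPad S) x.length d) :
    emuD A₀ bA c (boolPair (false :: x) d) = Oracle.ofLanguage S x := by
  set w := boolPair (false :: x) d with hw
  have hO := ansD_record x d
  have hagree : ∀ y : List Bool, y.length < x.length →
      Oracle.ofLanguage (padOracleLang x.length d) y = Oracle.ofLanguage S y :=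
    fun y hy => ofLanguage_congr (mem_padOracleLang_iff hd hy)
  have hxw : x.length ≤ w.length := by rw [hw, length_boolPair, List.length_cons]; omega
  have hpre : preD w = x := by rw [hw]; simp [preD]
  unfold emuD
  refine OracleAlg.simFn_eq_of_run ?_ ?_
  · rw [hO, hpre]
    exact A₀.run_mono _ x (natPoly_eval_mono bA hxw) (hdsr x _ hagree)
  · intro q hq
    rw [hO, hpre] at hq
    have h1 := hc (Oracle.ofLanguage (padOracleLang x.length d)) (fun q => le_of_eq rfl) _ x q hq
    refine h1.trans ?_
    rw [eval_comp, eval_add, eval_X]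
    exact natPoly_eval_mono c (Nat.add_le_add_right hxw _)

/-- **Correctness of MW's reduction `A`** on words of length `ℓ + 1` against a description of the
slice at length `ℓ`. [cite: MurrayWilliams2018, Thm. 2.2 (SIAM Thm. 2.7, proof: "Observe A is a downward self-reduction for L_PSPACE")] -/
theorem correct
    (hdsr : ∀ (x : List Bool) (O : Oracle), (∀ y : List Bool, y.length < x.length → O y = Oracle.ofLanguage S y) →
      A₀.run O (bA.eval x.length) x = some (Oracle.ofLanguage S x))
    (hc : ∀ O : Oracle, (∀ q, (O q).length ≤ 1) → ∀ (k : ℕ) (x : List Bool),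
      ∀ q ∈ A₀.queries O k x, q.length ≤ c.eval (x.length + k))
    (ℓ : ℕ) (d : List Bool) (hd : AlmostAE.DescribesSlice (onesZeroPad S) ℓ d)
    (z : List Bool) (hz : z.length = ℓ + 1) : boolPair z d ∈ lang A₀ bA c ↔ z ∈ onesZeroPad S := by
  change dsrFn A₀ bA c (boolPair z d) = [true] ↔ _
  cases z with
  | nil => simp at hz
  | cons b z' =>
    rw [List.length_cons, Nat.add_right_cancel_iff] at hz
    cases b
    · -- `z = 0 x`: the emulation of `A₀`
      subst hz
      rw [dsrFn_false_cons, emuD_false_cons hdsr hc hd, false_cons_mem_iff, Oracle.ofLanguage_apply]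
      change [S.boolIndicator z'] = [true] ↔ _
      rw [List.cons.injEq]
      constructor
      · exact fun h => (Set.mem_iff_boolIndicator _ _).2 h.1
      · exact fun h => ⟨(Set.mem_iff_boolIndicator _ _).1 h, rfl⟩
    · -- `z = 1 z'`: one query
      rw [dsrFn_true_cons, true_cons_mem_iff]
      exact SLChecker.mem_descLang_iff_of_describesSlice hd hz

end DSRM

/-- **Downward self-reducibility of the padded language** (Murray–Williams, SIAM Thm. 2.7): a
polynomial-time downward self-reduction `A₀` of `S` in the machine form of Impagliazzo–Wigderson's
Def. 6 / MW Def. 2.5 — an oracle algorithm with a polynomial round budget `bA` that outputs `[x ∈ S]`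
on `x` against EVERY oracle answering `S` on the queries shorter than `x` — yields the tree's
description-form `AlmostAE.DSR (onesZeroPad S)` (`MurrayWilliams2018DSR.lean`), by MW's reduction
`A` (`DSRM.dsrFn`; the query cap is that of `A₀` against one-bit oracles,
`OracleAlg.IsPolyTime.exists_queryBound`). [cite: MurrayWilliams2018, Thm. 2.2 (SIAM J. Comput. 49, Thm. 2.7: "L_PSPACE is downward self-reducible")] -/
def _root_.Literature.Computability.Complexity.AlmostAE.DSR.ofOnesZeroPad (S : Language Bool)
    (A₀ : OracleAlg (List Bool)) (hA₀ : A₀.IsPolyTime (encodingList Bool)) (bA : Polynomial ℕ)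
    (hdsr : ∀ (x : List Bool) (O : Oracle), (∀ y : List Bool, y.length < x.length → O y = Oracle.ofLanguage S y) →
      A₀.run O (bA.eval x.length) x = some (Oracle.ofLanguage S x)) :
    AlmostAE.DSR (onesZeroPad S) where
  lang := DSRM.lang A₀ bA (Classical.choose hA₀.exists_queryBound)
  mem_P := DSRM.lang_mem_P A₀ bA _ hA₀
  correct := DSRM.correct hdsr fun O hO k x => ((Classical.choose_spec hA₀.exists_queryBound) O hO k x).1

/-! ### Same-length checkability of the padded language (Santhanam's Lemma 12 step) -/

namespace ChkM

variable (M : ProbOracleMachine) (c : Polynomial ℕ)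

/-- The payload `x` of the input `z = 1ⁱ 0 x` (`z = fst (fst w)` on `w = ⟨⟨z, r⟩, d⟩`).
[cite: MurrayWilliams2018, Thm. 2.2 (SIAM Thm. 2.7, proof: "parse y = 1ᵐ0x")] -/
def xOf : List Bool → List Bool := fun w => (MWProtocol.stripOnes (fstF (fstF w))).drop 1

/-- The input handed to the checker of `S`: `⟨x, r⟩` (payload and coins). [folklore] -/
def preC : List Bool → List Bool := fun w => boolPair (xOf w) (sndF (fstF w))

/-- The answer rule: on the record `u = ⟨w, q⟩`, `w = ⟨⟨z, r⟩, d⟩`, the query `q` of the checker of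
`S` is answered by the description at the padded query of the INPUT's length `|z|`:
`evalFn ⟨padTo |z| q, d⟩` — Santhanam's same-length queries. [cite: MurrayWilliams2018, Thm. 2.2 (SIAM Thm. 2.7 (1): "M asks its oracle queries only of length |x|")] -/
def ansC : List Bool → List Bool := fun u =>
  evalFn (boolPair (padTo (fstF (fstF (fstF u))).length (sndF u)) (sndF (fstF u)))

/-- The emulation of the (clocked, coin-cut) checker `SLChecker.chk M` on `⟨x, r⟩` with the
re-padded queries. [cite: MurrayWilliams2018, Thm. 2.2 (SIAM Thm. 2.7)] -/
def emuC : List Bool → List Bool :=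
  OracleAlg.simFn (SLChecker.chk M) preC ansC (c.comp (X + (M.fuel + 1))) (M.fuel + 1)

/-- The all-ones test: `stripOnes z = ε` (then `z ∉ onesZeroPad S` and Arthur rejects outright). [folklore] -/
def nilTest : List Bool → List Bool := fun w => [decide (MWProtocol.stripOnes (fstF (fstF w)) = [])]

/-- **The same-length checker of the padded language**, run against the description in its input:
reject all-ones inputs; otherwise run the checker of `S` on the payload, coins from `r`, every query
`x'` answered by `d(1…1 0 x')` of the input's length. [cite: MurrayWilliams2018, Thm. 2.2 (SIAM Thm. 2.7, the checker M)] -/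
def chkFn : List Bool → List Bool := iteFn nilTest (fun _ => [false]) (emuC M c)

/-- Its language (Arthur's verdict on `⟨⟨z, r⟩, d⟩`). [cite: MurrayWilliams2018, Thm. 2.2 (SIAM Thm. 2.7)] -/
def lang : Language Bool := {w | chkFn M c w = [true]}

/-! #### Polynomial time -/

/-- `xOf` computed on codes. [folklore] -/
theorem xOfC : CodeFP strE strE xOf :=
  (strDrop.comp ((CodeFP.const strE (eβ := unE) 1).pair
    (MWProtocol.stripOnesC.comp (MWProtocol.fstC.comp MWProtocol.fstC)))).congr fun _ => rfl

/-- `preC ∈ FP`. [folklore] -/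
theorem preC_mem_FP : preC ∈ FP :=
  codeFP_strE_iff.1 ((MWProtocol.strPairC.comp (xOfC.pair (MWProtocol.sndC.comp MWProtocol.fstC))).congr
    fun _ => rfl)

/-- The re-padded query as a string map on `u = ⟨⟨⟨z, r⟩, d⟩, q⟩`, computed on codes. [folklore] -/
theorem padQueryC : CodeFP strE strE (fun u => padTo (fstF (fstF (fstF u))).length (sndF u)) := by
  refine (strAppend.comp ((strDrop.comp ((unSucc.comp (strLength.comp MWProtocol.sndC)).pair
    (strOfUn.comp (strLength.comp (MWProtocol.fstC.comp (MWProtocol.fstC.comp MWProtocol.fstC)))))).pair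
    (strAppend.comp ((CodeFP.const strE (eβ := strE) [false]).pair MWProtocol.sndC)))).congr fun u => ?_
  dsimp only
  rw [padTo_eq_drop, unE_eq_ones]

/-- `ansC ∈ FP`. [folklore] -/
theorem ansC_mem_FP : ansC ∈ FP :=
  comp_mem_FP evalFn_mem_FP (codeFP_strE_iff.1
    ((MWProtocol.strPairC.comp (padQueryC.pair (MWProtocol.sndC.comp MWProtocol.fstC))).congr fun _ => rfl))

/-- `emuC ∈ FP` for a probabilistic polynomial-time `M`. [cite: AroraBarakCC2009, §3.4 (emulating an oracle machine)] -/
theorem emuC_mem_FP (hM : M.IsPPT encodingBoolBool) : emuC M c ∈ FP :=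
  OracleAlg.simFn_mem_FP (SLChecker.isPolyTime_chk M hM) preC_mem_FP ansC_mem_FP _ _

/-- `nilTest ∈ FP`. [folklore] -/
theorem nilTest_mem_FP : nilTest ∈ FP :=
  mem_FP_of_codeFP_bit ((CodeFP.eq (eα := strE) Function.injective_id).comp
    ((MWProtocol.stripOnesC.comp (MWProtocol.fstC.comp MWProtocol.fstC)).pair
      (CodeFP.const strE (eβ := strE) ([] : List Bool))))

/-- **`chkFn ∈ FP`.** [cite: MurrayWilliams2018, Thm. 2.2 (SIAM Thm. 2.7: M is probabilistic polynomial time)] -/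
theorem chkFn_mem_FP (hM : M.IsPPT encodingBoolBool) : chkFn M c ∈ FP :=
  iteFn_mem_FP nilTest_mem_FP (const_mem_FP _) (emuC_mem_FP M c hM)

/-- **`lang ∈ P`.** [cite: MurrayWilliams2018, Thm. 2.2 (SIAM Thm. 2.7)] -/
theorem lang_mem_P (hM : M.IsPPT encodingBoolBool) : lang M c ∈ Classes.P :=
  setOf_apply_eq_apply_mem_P (chkFn_mem_FP M c hM) (const_mem_FP [true])

/-! #### Semantics -/

/-- On an all-ones input the checker rejects. [folklore] -/
theorem chkFn_replicate (a : ℕ) (r d : List Bool) :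
    chkFn M c (boolPair (boolPair (List.replicate a true) r) d) = [false] := by
  unfold chkFn
  rw [iteFn_apply_true (by simp [nilTest])]

/-- On `z = 1ᵃ 0 x` the checker emulates the checker of `S`. [folklore] -/
theorem chkFn_padded (a : ℕ) (x r d : List Bool) :
    chkFn M c (boolPair (boolPair (List.replicate a true ++ false :: x) r) d) =
      emuC M c (boolPair (boolPair (List.replicate a true ++ false :: x) r) d) := by
  unfold chkFn
  rw [iteFn_apply_false (by simp [nilTest])]

/-- The oracle the emulation presents to the checker of `S` on `w = ⟨⟨z, r⟩, d⟩`: `padOracleLang |z| d`.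
[folklore] -/
theorem ansC_record (z r d : List Bool) :
    (fun q => ansC (boolPair (boolPair (boolPair z r) d) q)) = Oracle.ofLanguage (padOracleLang z.length d) := by
  funext q
  simp only [ansC, fstF_boolPair, sndF_boolPair]
  exact evalFn_padTo _ _ _

variable {M c}

/-- **Semantics of the emulation** on `w = ⟨⟨1ᵃ 0 x, r⟩, d⟩` (queries of the clocked checker against
one-bit oracles capped by `c`): the verdict of `M` on `x` with coins `r ↾ coins(|x|)` and the oracle
`padOracleLang |z| d`. [cite: MurrayWilliams2018, Thm. 2.2 (SIAM Thm. 2.7)] -/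
theorem emuC_padded
    (hc : ∀ O : Oracle, (∀ q, (O q).length ≤ 1) → ∀ (k : ℕ) (y : List Bool),
      ∀ q ∈ (SLChecker.chk M).queries O k y, q.length ≤ c.eval (y.length + k))
    (a : ℕ) (x r d : List Bool) :
    emuC M c (boolPair (boolPair (List.replicate a true ++ false :: x) r) d) =
      [SLChecker.accB M (Oracle.ofLanguage (padOracleLang (a + (x.length + 1)) d)) x r] := by
  set z := List.replicate a true ++ false :: x with hz
  set w := boolPair (boolPair z r) d with hw
  have hzl : z.length = a + (x.length + 1) := by rw [hz, List.length_append, List.length_replicate, List.length_cons]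
  have hO := ansC_record z r d
  rw [hzl] at hO
  have hpre : preC w = boolPair x r := by
    rw [hw]; simp [preC, xOf, hz]
  have hxw : (boolPair x r).length ≤ w.length := by
    rw [hw, length_boolPair, length_boolPair, length_boolPair, hzl]; omega
  have hfuel : M.fuel.eval x.length < (M.fuel + 1).eval w.length := by
    rw [eval_add, eval_one]
    have : x.length ≤ w.length := by rw [length_boolPair] at hxw; omega
    exact Nat.lt_succ_of_le (natPoly_eval_mono M.fuel this)
  unfold emuC
  refine OracleAlg.simFn_eq_of_run ?_ ?_
  · rw [hO, hpre]
    exact SLChecker.run_chk M _ x r hfuel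
  · intro q hq
    rw [hO, hpre] at hq
    have h1 := hc (Oracle.ofLanguage (padOracleLang (a + (x.length + 1)) d)) (fun q => le_of_eq rfl) _ _ q hq
    refine h1.trans ?_
    simp only [eval_comp, eval_add, eval_X, eval_one]
    exact natPoly_eval_mono c (by omega)

/-- Membership of `⟨⟨1ᵃ 0 x, r⟩, d⟩` in the checker's language. [cite: MurrayWilliams2018, Thm. 2.2 (SIAM Thm. 2.7)] -/
theorem mem_lang_padded_iff
    (hc : ∀ O : Oracle, (∀ q, (O q).length ≤ 1) → ∀ (k : ℕ) (y : List Bool),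
      ∀ q ∈ (SLChecker.chk M).queries O k y, q.length ≤ c.eval (y.length + k))
    (a : ℕ) (x r d : List Bool) :
    boolPair (boolPair (List.replicate a true ++ false :: x) r) d ∈ lang M c ↔
      M.alg.run (Oracle.ofLanguage (padOracleLang (a + (x.length + 1)) d)) (M.fuel.eval x.length)
        (boolPair x (r.take (M.coins.eval x.length))) = some true := by
  change chkFn M c _ = [true] ↔ _
  rw [chkFn_padded, emuC_padded hc, ← SLChecker.accB_eq_true_iff]
  simp

/-- **Completeness**: if the checker of `S` accepts every `x ∈ S` with probability `1` against every
oracle that answers `S` on the queries of length `≤ |x|`, then behind a description of the slice of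
the padded language at the input's length `ℓ = a + 1 + |x|` (which answers `S` on all queries shorter
than `ℓ`) every coin string accepts `1ᵃ 0 x`. [cite: MurrayWilliams2018, Thm. 2.2 (SIAM Thm. 2.7 (2))] -/
theorem complete
    (hc : ∀ O : Oracle, (∀ q, (O q).length ≤ 1) → ∀ (k : ℕ) (y : List Bool),
      ∀ q ∈ (SLChecker.chk M).queries O k y, q.length ≤ c.eval (y.length + k))
    (hcomp : ∀ x ∈ S, ∀ A : Language Bool, (∀ y : List Bool, y.length ≤ x.length → (y ∈ A ↔ y ∈ S)) →
      ∀ r : List Bool, r.length = M.coins.eval x.length →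
        M.alg.run (Oracle.ofLanguage A) (M.fuel.eval x.length) (boolPair x r) = some true)
    (ℓ : ℕ) (d : List Bool) (hd : AlmostAE.DescribesSlice (onesZeroPad S) ℓ d)
    (z : List Bool) (hz : z ∈ onesZeroPad S) (hzℓ : z.length = ℓ) (r : List Bool) (hr : r.length = M.coins.eval ℓ) :
    boolPair (boolPair z r) d ∈ lang M c := by
  obtain ⟨a, x, rfl, hx⟩ := hz
  rw [List.length_append, List.length_replicate, List.length_cons] at hzℓ
  rw [mem_lang_padded_iff hc, hzℓ]
  have hxl : x.length ≤ ℓ := by omega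
  refine hcomp x hx _ (fun y hy => mem_padOracleLang_iff hd (by omega)) _ ?_
  rw [List.length_take, hr]
  exact Nat.min_eq_left (natPoly_eval_mono M.coins hxl)

/-- **Soundness**: if the checker of `S` accepts every `x ∉ S` with probability `≤ 1/3` whatever
one-bit oracle it is given, then Arthur accepts a word outside the padded language with probability
`≤ 1/3` over `coins(ℓ)` coins, whatever the description (all-ones words are rejected outright; on
`1ᵃ 0 x` the coin prefix of length `coins(|x|)` is uniform, `uniformProb_take_of_le`).
[cite: MurrayWilliams2018, Thm. 2.2 (SIAM Thm. 2.7 (3))] -/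
theorem sound
    (hc : ∀ O : Oracle, (∀ q, (O q).length ≤ 1) → ∀ (k : ℕ) (y : List Bool),
      ∀ q ∈ (SLChecker.chk M).queries O k y, q.length ≤ c.eval (y.length + k))
    (hsound : ∀ (A : Language Bool) (x : List Bool), x ∉ S → M.acceptProbOn (Oracle.ofLanguage A) x ≤ 1 / 3)
    (z : List Bool) (hz : z ∉ onesZeroPad S) (d : List Bool) :
    uniformProb (M.coins.eval z.length) {r | boolPair (boolPair z r) d ∈ lang M c} ≤ 1 / 3 := by
  rcases MWProtocol.eq_replicate_or_exists z with ⟨hz1, -⟩ | ⟨a, x, hzx, -⟩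
  · -- all ones: the event is empty
    have hE : {r | boolPair (boolPair z r) d ∈ lang M c} = ∅ := by
      refine Set.eq_empty_iff_forall_notMem.2 fun r hr => ?_
      change chkFn M c _ = [true] at hr
      rw [hz1, chkFn_replicate] at hr
      exact absurd hr (by simp)
    rw [hE, uniformProb_empty]
    norm_num
  · subst hzx
    have hx : x ∉ S := fun hx => hz ((replicate_append_mem_iff a x).2 hx)
    set A := padOracleLang (a + (x.length + 1)) d with hA
    have hlen : (List.replicate a true ++ false :: x).length = a + (x.length + 1) := by
      rw [List.length_append, List.length_replicate, List.length_cons]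
    have hcx : M.coins.eval x.length ≤ M.coins.eval (a + (x.length + 1)) := natPoly_eval_mono M.coins (by omega)
    have hE : {r | boolPair (boolPair (List.replicate a true ++ false :: x) r) d ∈ lang M c} =
        {r | r.take (M.coins.eval x.length) ∈
          {r' | M.alg.run (Oracle.ofLanguage A) (M.fuel.eval x.length) (boolPair x r') = some true}} := by
      ext r
      simp only [Set.mem_setOf_eq]
      exact mem_lang_padded_iff hc a x r d
    rw [hlen, hE, uniformProb_take_of_le hcx, ← OracleAdversary.acceptProbOn_eq]
    exact hsound A x hx

end ChkM

/-- **Same-length checkability of the padded language** (Murray–Williams, SIAM Thm. 2.7 after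
Santhanam's Lemma 12): a probabilistic polynomial-time oracle machine `M` checking `S` DOWNWARD — it
accepts every `x ∈ S` with probability `1` against every oracle answering `S` on the queries of length
`≤ |x|` (the semantic content of "queries of length at most `|x|`"), and accepts every `x ∉ S` with
probability `≤ 1/3` whatever one-bit oracle it is given — yields the tree's
`AlmostAE.SameLengthChecker (onesZeroPad S)` (`MurrayWilliams2018Protocol.lean`): Arthur rejects
all-ones inputs and otherwise runs `M` on the payload `x` of `1ⁱ 0 x`, re-asking each query `x'` as
`1…1 0 x'` of the input's length (`ChkM.chkFn`), with `M`'s coin polynomial (a prefix of the coins is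
used). [cite: MurrayWilliams2018, Thm. 2.2 (SIAM J. Comput. 49, Thm. 2.7: "checkable … M asks its oracle queries only of length |x|")] -/
def _root_.Literature.Computability.Complexity.AlmostAE.SameLengthChecker.ofOnesZeroPad (S : Language Bool)
    (M : ProbOracleMachine) (hM : M.IsPPT encodingBoolBool)
    (hcomp : ∀ x ∈ S, ∀ A : Language Bool, (∀ y : List Bool, y.length ≤ x.length → (y ∈ A ↔ y ∈ S)) →
      ∀ r : List Bool, r.length = M.coins.eval x.length →
        M.alg.run (Oracle.ofLanguage A) (M.fuel.eval x.length) (boolPair x r) = some true)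
    (hsound : ∀ (A : Language Bool) (x : List Bool), x ∉ S → M.acceptProbOn (Oracle.ofLanguage A) x ≤ 1 / 3) :
    AlmostAE.SameLengthChecker (onesZeroPad S) where
  lang := ChkM.lang M (Classical.choose (SLChecker.isPolyTime_chk M hM).exists_queryBound)
  mem_P := ChkM.lang_mem_P M _ hM
  coins := M.coins
  complete ℓ d hd z hz hzℓ r hr :=
    ChkM.complete (fun O hO k y => ((Classical.choose_spec (SLChecker.isPolyTime_chk M hM).exists_queryBound) O hO k y).1)
      hcomp ℓ d hd z hz hzℓ r hr
  sound z hz d :=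
    ChkM.sound (fun O hO k y => ((Classical.choose_spec (SLChecker.isPolyTime_chk M hM).exists_queryBound) O hO k y).1)
      hsound z hz d

/-! ### From syntactic query-length bounds to the semantic hypotheses -/

/-- A checker of `S` whose queries on `⟨x, r⟩` have length `≤ |x|` (the printed clause, for every
oracle and round budget) and which is perfectly complete with the oracle `S` is perfectly complete
against every oracle answering `S` on the queries of length `≤ |x|` — the hypothesis `hcomp` of
`AlmostAE.SameLengthChecker.ofOnesZeroPad` (a run only depends on the answers to the queries asked,
`OracleAlg.run_congr_oracle`). [cite: MurrayWilliams2018, Thm. 2.2 (SIAM Thm. 2.7 (1)–(2))] -/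
theorem hcomp_of_queryLength (M : ProbOracleMachine)
    (hql : ∀ (O : Oracle) (k : ℕ) (x r : List Bool), ∀ q ∈ M.alg.queries O k (boolPair x r), q.length ≤ x.length)
    (hcomp₀ : ∀ x ∈ S, ∀ r : List Bool, r.length = M.coins.eval x.length →
      M.alg.run (Oracle.ofLanguage S) (M.fuel.eval x.length) (boolPair x r) = some true) :
    ∀ x ∈ S, ∀ A : Language Bool, (∀ y : List Bool, y.length ≤ x.length → (y ∈ A ↔ y ∈ S)) →
      ∀ r : List Bool, r.length = M.coins.eval x.length →
        M.alg.run (Oracle.ofLanguage A) (M.fuel.eval x.length) (boolPair x r) = some true := by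
  intro x hx A hA r hr
  rw [OracleAlg.run_congr_oracle M.alg (Oracle.ofLanguage A) (Oracle.ofLanguage S) _ _
    fun q hq => ofLanguage_congr (hA q (hql _ _ x r q hq))]
  exact hcomp₀ x hx r hr

/-- A downward self-reduction of `S` whose queries on `x` are shorter than `x` (for every oracle and
round budget) and which is correct with the oracle `S` is correct against every oracle answering `S`
on the shorter queries — the hypothesis `hdsr` of `AlmostAE.DSR.ofOnesZeroPad` (IW Def. 6 form).
[cite: MurrayWilliams2018, Def. 2.5 (SIAM: `A^{L_{n-1}}(x) = L(x)`)] -/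
theorem hdsr_of_queryLength (A₀ : OracleAlg (List Bool)) (bA : Polynomial ℕ)
    (hql : ∀ (O : Oracle) (k : ℕ) (x : List Bool), ∀ q ∈ A₀.queries O k x, q.length < x.length)
    (hdsr₀ : ∀ x : List Bool, A₀.run (Oracle.ofLanguage S) (bA.eval x.length) x = some (Oracle.ofLanguage S x)) :
    ∀ (x : List Bool) (O : Oracle), (∀ y : List Bool, y.length < x.length → O y = Oracle.ofLanguage S y) →
      A₀.run O (bA.eval x.length) x = some (Oracle.ofLanguage S x) := by
  intro x O hO
  rw [OracleAlg.run_congr_oracle A₀ O (Oracle.ofLanguage S) _ _ fun q hq => hO q (hql _ _ x q hq)]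
  exact hdsr₀ x

end OnesZeroPad

/-! ### Theorem 2.2's language from a downward self-reducible, downward-checkable hard language -/

/-- **Murray–Williams' Theorem 2.2 (SIAM Thm. 2.7), the construction**: from a `PSPACE`-hard
language `S` with a polynomial-time downward self-reduction (machine form, IW Def. 6 / MW Def. 2.5)
and a probabilistic polynomial-time DOWNWARD checker (complete with probability `1` against every
oracle answering `S` on the queries of length `≤ |x|`, `1/3`-sound against every one-bit oracle) —
the data Trevisan–Vadhan's language supplies — the padded language `onesZeroPad S = {1ⁱ 0 x : x ∈ S}`
has the five properties the tree's headline consumes: `PSPACE`-hard, paddable, without all-ones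
words, downward self-reducible (`AlmostAE.DSR`) and same-length checkable
(`AlmostAE.SameLengthChecker`). [cite: MurrayWilliams2018, Thm. 2.2 (SIAM J. Comput. 49, Thm. 2.7 and its proof)] -/
theorem MurrayWilliams2018_thm_2_2_language_of_downwardCheckable (S : Language Bool)
    (hhard : IsHard PSPACE S)
    (A₀ : OracleAlg (List Bool)) (hA₀ : A₀.IsPolyTime (encodingList Bool)) (bA : Polynomial ℕ)
    (hdsr : ∀ (x : List Bool) (O : Oracle), (∀ y : List Bool, y.length < x.length → O y = Oracle.ofLanguage S y) →
      A₀.run O (bA.eval x.length) x = some (Oracle.ofLanguage S x))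
    (M : ProbOracleMachine) (hM : M.IsPPT encodingBoolBool)
    (hcomp : ∀ x ∈ S, ∀ A : Language Bool, (∀ y : List Bool, y.length ≤ x.length → (y ∈ A ↔ y ∈ S)) →
      ∀ r : List Bool, r.length = M.coins.eval x.length →
        M.alg.run (Oracle.ofLanguage A) (M.fuel.eval x.length) (boolPair x r) = some true)
    (hsound : ∀ (A : Language Bool) (x : List Bool), x ∉ S → M.acceptProbOn (Oracle.ofLanguage A) x ≤ 1 / 3) :
    ∃ Lstar : Language Bool, IsHard PSPACE Lstar ∧
      (∀ z : List Bool, true :: z ∈ Lstar ↔ z ∈ Lstar) ∧ (∀ b : ℕ, List.replicate b true ∉ Lstar) ∧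
      Nonempty (AlmostAE.DSR Lstar) ∧ Nonempty (AlmostAE.SameLengthChecker Lstar) :=
  ⟨onesZeroPad S, OnesZeroPad.isHard hhard, OnesZeroPad.true_cons_mem_iff, OnesZeroPad.replicate_not_mem,
    ⟨AlmostAE.DSR.ofOnesZeroPad S A₀ hA₀ bA hdsr⟩, ⟨AlmostAE.SameLengthChecker.ofOnesZeroPad S M hM hcomp hsound⟩⟩

/-- **`NQP ⊄ ACC⁰` from a `PSPACE`-hard, downward self-reducible, downward-checkable language**
(Trevisan–Vadhan's data), through Theorem 2.2's padding and
`MurrayWilliams2018_NQP_not_subset_ACC0_of_exists_thm_2_2_language` (Thm. 3.1, Lemma 4.1 in the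
polylogarithmic-seed form, Lemma 1.3, machine `B`, Williams' Fact 3.1 / Thm. 4.1 and MW Thm. 5.1 are
theorems of the tree). [cite: MurrayWilliams2018, §1.1, Thm. 2.2, Thm. 3.1, Lemma 4.1, Thm. 1.3] -/
theorem MurrayWilliams2018_NQP_not_subset_ACC0_of_downwardCheckable (S : Language Bool)
    (hhard : IsHard PSPACE S)
    (A₀ : OracleAlg (List Bool)) (hA₀ : A₀.IsPolyTime (encodingList Bool)) (bA : Polynomial ℕ)
    (hdsr : ∀ (x : List Bool) (O : Oracle), (∀ y : List Bool, y.length < x.length → O y = Oracle.ofLanguage S y) →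
      A₀.run O (bA.eval x.length) x = some (Oracle.ofLanguage S x))
    (M : ProbOracleMachine) (hM : M.IsPPT encodingBoolBool)
    (hcomp : ∀ x ∈ S, ∀ A : Language Bool, (∀ y : List Bool, y.length ≤ x.length → (y ∈ A ↔ y ∈ S)) →
      ∀ r : List Bool, r.length = M.coins.eval x.length →
        M.alg.run (Oracle.ofLanguage A) (M.fuel.eval x.length) (boolPair x r) = some true)
    (hsound : ∀ (A : Language Bool) (x : List Bool), x ∉ S → M.acceptProbOn (Oracle.ofLanguage A) x ≤ 1 / 3) :
    MurrayWilliams2018_NQP_not_subset_ACC0 :=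
  MurrayWilliams2018_NQP_not_subset_ACC0_of_exists_thm_2_2_language
    (MurrayWilliams2018_thm_2_2_language_of_downwardCheckable S hhard A₀ hA₀ bA hdsr M hM hcomp hsound)

/-- **Lemma 4.1 (a.e. form, `MurrayWilliams2018_lemma_4_1_ae`) from the same data and a generator of
Umans' type** (MW Thm. 2.1 = Umans 2003, rendered as the structure `UmansGenerator` of
`MurrayWilliams2018SimulationProofs.lean`), through Theorem 2.2's padding and
`MurrayWilliams2018_lemma_4_1_ae_of_sameLengthChecker_of_umansGenerator` (Thm. 3.1 both halves, the
§4 assembly and the simulation `N` are theorems of the tree). With this theorem the named fact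
`MurrayWilliams2018_lemma_4_1_ae` rests on exactly: Trevisan–Vadhan's language (hardness, downward
self-reduction, downward checker) and Umans' generator.
[cite: MurrayWilliams2018, Lemma 4.1, Thm. 2.1, Thm. 2.2 and Thm. 3.1] -/
theorem MurrayWilliams2018_lemma_4_1_ae_of_downwardCheckable_of_umansGenerator (S : Language Bool)
    (hhard : IsHard PSPACE S)
    (A₀ : OracleAlg (List Bool)) (hA₀ : A₀.IsPolyTime (encodingList Bool)) (bA : Polynomial ℕ)
    (hdsr : ∀ (x : List Bool) (O : Oracle), (∀ y : List Bool, y.length < x.length → O y = Oracle.ofLanguage S y) →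
      A₀.run O (bA.eval x.length) x = some (Oracle.ofLanguage S x))
    (M : ProbOracleMachine) (hM : M.IsPPT encodingBoolBool)
    (hcomp : ∀ x ∈ S, ∀ A : Language Bool, (∀ y : List Bool, y.length ≤ x.length → (y ∈ A ↔ y ∈ S)) →
      ∀ r : List Bool, r.length = M.coins.eval x.length →
        M.alg.run (Oracle.ofLanguage A) (M.fuel.eval x.length) (boolPair x r) = some true)
    (hsound : ∀ (A : Language Bool) (x : List Bool), x ∉ S → M.acceptProbOn (Oracle.ofLanguage A) x ≤ 1 / 3)
    (G : UmansGenerator) : MurrayWilliams2018_lemma_4_1_ae :=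
  MurrayWilliams2018_lemma_4_1_ae_of_sameLengthChecker_of_umansGenerator (onesZeroPad S)
    (OnesZeroPad.isHard hhard) OnesZeroPad.true_cons_mem_iff OnesZeroPad.replicate_not_mem
    (AlmostAE.DSR.ofOnesZeroPad S A₀ hA₀ bA hdsr) (AlmostAE.SameLengthChecker.ofOnesZeroPad S M hM hcomp hsound) G

/-! ### Downward checkers in description form (an `FP` functional of an oracle-access brick) -/

/-- **A downward checker of `S` in description form**: a string function `chk acc` on `⟨⟨x, r⟩, e⟩`
(input, coins, oracle carrier) PARAMETRIZED by an access brick `acc` answering each oracle query `q` as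
`acc ⟨q, e⟩` (accepting answer `[1]`), polynomial-time uniformly in `acc` (`acc ∈ FP → chk acc ∈ FP`),
reading at most `coins |x|` coins, which
(1) accepts every `x ∈ S` with every coin string whenever the access brick answers `S` on the queries
NOT LONGER than `x` (downward: queries longer than `x` do not matter), and
(2) accepts every `x ∉ S` with probability `≤ 1/3` whatever `acc` and `e` are.
This is the form in which Murray–Williams' Arthur uses Santhanam's machine (Lemma 12: "a probabilistic
polynomial-time oracle Turing machine M such that … M only asks its oracle queries of length |x|";
there Merlin's circuit answers the queries) — here with the oracle of the SHORTER lengths, the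
same-length discipline being restored by the padding `1ⁱ 0 x` (`SameLengthChecker.ofDownwardFn`).
[cite: Santhanam2009, Lemma 12] [cite: MurrayWilliams2018, Thm. 2.2 (SIAM Thm. 2.7)] -/
structure DownwardCheckerFn (S : Language Bool) where
  /-- the checker, as a functional of the oracle-access brick -/
  chk : (List Bool → List Bool) → List Bool → List Bool
  /-- the number of coins read on inputs of length `n` -/
  coins : Polynomial ℕ
  /-- polynomial time, uniformly in the access brick -/
  mem_FP : ∀ {acc : List Bool → List Bool}, acc ∈ FP → chk acc ∈ FP
  /-- perfect completeness behind every access brick right on the queries not longer than the input -/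
  complete : ∀ (acc : List Bool → List Bool) (e x : List Bool), x ∈ S →
    (∀ q : List Bool, q.length ≤ x.length → (acc (boolPair q e) = [true] ↔ q ∈ S)) →
    ∀ r : List Bool, coins.eval x.length ≤ r.length → chk acc (boolPair (boolPair x r) e) = [true]
  /-- soundness `1/3` whatever the access brick -/
  sound : ∀ (acc : List Bool → List Bool) (e x : List Bool), x ∉ S →
    ∀ L : ℕ, coins.eval x.length ≤ L → uniformProb L {r | chk acc (boolPair (boolPair x r) e) = [true]} ≤ 1 / 3

namespace OnesZeroPad

variable {S : Language Bool}

namespace ChkF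

variable (C : DownwardCheckerFn S)

/-- The access brick of the padded language: on `u = ⟨q, ⟨z, d⟩⟩` answer the query `q` (about `S`) by
the description `d` at the padded query of the input's length, `evalFn ⟨padTo |z| q, d⟩`.
[cite: MurrayWilliams2018, Thm. 2.2 (SIAM Thm. 2.7 (1): "M asks its oracle queries only of length |x|")] -/
def accF : List Bool → List Bool := fun u => evalFn (boolPair (padTo (fstF (sndF u)).length (fstF u)) (sndF (sndF u)))

/-- The re-padded query of `u = ⟨q, ⟨z, d⟩⟩`, computed on codes. [folklore] -/
theorem padQueryC' : CodeFP strE strE (fun u => padTo (fstF (sndF u)).length (fstF u)) := by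
  refine (strAppend.comp ((strDrop.comp ((unSucc.comp (strLength.comp MWProtocol.fstC)).pair
    (strOfUn.comp (strLength.comp (MWProtocol.fstC.comp MWProtocol.sndC))))).pair
    (strAppend.comp ((CodeFP.const strE (eβ := strE) [false]).pair MWProtocol.fstC)))).congr fun u => ?_
  dsimp only
  rw [padTo_eq_drop, unE_eq_ones]

/-- `accF ∈ FP`. [folklore] -/
theorem accF_mem_FP : accF ∈ FP :=
  comp_mem_FP evalFn_mem_FP (codeFP_strE_iff.1
    ((MWProtocol.strPairC.comp (padQueryC'.pair (MWProtocol.sndC.comp MWProtocol.sndC))).congr fun _ => rfl))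

/-- The access brick presents `padOracleLang |z| d`. [folklore] -/
theorem accF_apply (q z d : List Bool) : accF (boolPair q (boolPair z d)) = Oracle.ofLanguage (padOracleLang z.length d) q := by
  simp only [accF, fstF_boolPair, sndF_boolPair]
  exact evalFn_padTo _ _ _

/-- Behind a description of the slice at length `|z|`, the access brick answers `S` on the queries
shorter than `z`. [cite: MurrayWilliams2018, Thm. 2.2 (SIAM Thm. 2.7, proof)] -/
theorem accF_true_iff {z d : List Bool} (hd : AlmostAE.DescribesSlice (onesZeroPad S) z.length d) {q : List Bool}
    (hq : q.length < z.length) : accF (boolPair q (boolPair z d)) = [true] ↔ q ∈ S := by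
  rw [accF_apply, ← mem_padOracleLang_iff hd hq, Oracle.ofLanguage_apply]
  by_cases h : q ∈ padOracleLang z.length d
  · rw [(Set.mem_iff_boolIndicator _ _).1 h]; simp [h, encodeBool]
  · rw [(Set.notMem_iff_boolIndicator _ _).1 h]; simp [h, encodeBool]

/-- The record handed to the downward checker: `⟨⟨x, r⟩, ⟨z, d⟩⟩` from `w = ⟨⟨z, r⟩, d⟩`, `x` the payload
of `z = 1ⁱ 0 x`. [folklore] -/
def preF : List Bool → List Bool := fun w =>
  boolPair (boolPair ((MWProtocol.stripOnes (fstF (fstF w))).drop 1) (sndF (fstF w))) (boolPair (fstF (fstF w)) (sndF w))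

/-- `preF ∈ FP`. [folklore] -/
theorem preF_mem_FP : preF ∈ FP :=
  codeFP_strE_iff.1 ((MWProtocol.strPairC.comp ((MWProtocol.strPairC.comp (ChkM.xOfC.pair (MWProtocol.sndC.comp MWProtocol.fstC))).pair
    (MWProtocol.strPairC.comp ((MWProtocol.fstC.comp MWProtocol.fstC).pair MWProtocol.sndC)))).congr fun _ => rfl)

/-- **Arthur's verdict for the padded language**: reject all-ones inputs, else run the downward checker
of `S` on the payload with the re-padding access brick. [cite: MurrayWilliams2018, Thm. 2.2 (SIAM Thm. 2.7, the checker M)] -/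
def chkFn : List Bool → List Bool := iteFn ChkM.nilTest (fun _ => [false]) (C.chk accF ∘ preF)

/-- Its language. [cite: MurrayWilliams2018, Thm. 2.2 (SIAM Thm. 2.7)] -/
def lang : Language Bool := {w | chkFn C w = [true]}

/-- **`chkFn ∈ FP`.** [cite: MurrayWilliams2018, Thm. 2.2 (SIAM Thm. 2.7: M is probabilistic polynomial time)] -/
theorem chkFn_mem_FP : chkFn C ∈ FP :=
  iteFn_mem_FP ChkM.nilTest_mem_FP (const_mem_FP _) (comp_mem_FP (C.mem_FP accF_mem_FP) preF_mem_FP)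

/-- **`lang ∈ P`.** [cite: MurrayWilliams2018, Thm. 2.2 (SIAM Thm. 2.7)] -/
theorem lang_mem_P : lang C ∈ Classes.P := setOf_apply_eq_apply_mem_P (chkFn_mem_FP C) (const_mem_FP [true])

/-- On an all-ones input Arthur rejects. [folklore] -/
theorem chkFn_replicate (a : ℕ) (r d : List Bool) : chkFn C (boolPair (boolPair (List.replicate a true) r) d) = [false] := by
  unfold chkFn
  rw [iteFn_apply_true (by simp [ChkM.nilTest])]

/-- On `z = 1ᵃ 0 x` Arthur runs the downward checker on `⟨⟨x, r⟩, ⟨z, d⟩⟩`. [folklore] -/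
theorem chkFn_padded (a : ℕ) (x r d : List Bool) :
    chkFn C (boolPair (boolPair (List.replicate a true ++ false :: x) r) d) =
      C.chk accF (boolPair (boolPair x r) (boolPair (List.replicate a true ++ false :: x) d)) := by
  unfold chkFn
  rw [iteFn_apply_false (by simp [ChkM.nilTest]), Function.comp_apply]
  simp [preF]

/-- **Completeness.** [cite: MurrayWilliams2018, Thm. 2.2 (SIAM Thm. 2.7 (2))] -/
theorem complete (ℓ : ℕ) (d : List Bool) (hd : AlmostAE.DescribesSlice (onesZeroPad S) ℓ d)
    (z : List Bool) (hz : z ∈ onesZeroPad S) (hzℓ : z.length = ℓ) (r : List Bool) (hr : r.length = C.coins.eval ℓ) :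
    boolPair (boolPair z r) d ∈ lang C := by
  obtain ⟨a, x, rfl, hx⟩ := hz
  change chkFn C _ = [true]
  rw [chkFn_padded]
  have hzl : (List.replicate a true ++ false :: x).length = ℓ := hzℓ
  rw [List.length_append, List.length_replicate, List.length_cons] at hzℓ
  subst hzl
  refine C.complete accF _ x hx (fun q hq => accF_true_iff hd (by rw [List.length_append, List.length_replicate, List.length_cons]; omega))
    r ?_
  rw [hr]
  exact natPoly_eval_mono C.coins (by rw [List.length_append, List.length_replicate, List.length_cons]; omega)

/-- **Soundness.** [cite: MurrayWilliams2018, Thm. 2.2 (SIAM Thm. 2.7 (3))] -/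
theorem sound (z : List Bool) (hz : z ∉ onesZeroPad S) (d : List Bool) :
    uniformProb (C.coins.eval z.length) {r | boolPair (boolPair z r) d ∈ lang C} ≤ 1 / 3 := by
  rcases MWProtocol.eq_replicate_or_exists z with ⟨hz1, -⟩ | ⟨a, x, hzx, -⟩
  · have hE : {r | boolPair (boolPair z r) d ∈ lang C} = ∅ := by
      refine Set.eq_empty_iff_forall_notMem.2 fun r hr => ?_
      change chkFn C _ = [true] at hr
      rw [hz1, chkFn_replicate] at hr
      exact absurd hr (by simp)
    rw [hE, uniformProb_empty]
    norm_num
  · subst hzx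
    have hx : x ∉ S := fun hx => hz ((replicate_append_mem_iff a x).2 hx)
    have hE : {r | boolPair (boolPair (List.replicate a true ++ false :: x) r) d ∈ lang C} =
        {r | C.chk accF (boolPair (boolPair x r) (boolPair (List.replicate a true ++ false :: x) d)) = [true]} := by
      ext r
      change chkFn C _ = [true] ↔ _
      rw [chkFn_padded]
      rfl
    rw [hE]
    refine C.sound accF _ x hx _ (natPoly_eval_mono C.coins ?_)
    rw [List.length_append, List.length_replicate, List.length_cons]; omega

end ChkF

/-- **Same-length checkability of the padded language from a description-form downward checker**
(Murray–Williams, SIAM Thm. 2.7 after Santhanam's Lemma 12, with Arthur's use of Merlin's circuit built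
in): Arthur rejects all-ones inputs and otherwise runs the downward checker of `S` on the payload `x`
of `1ⁱ 0 x`, every query `x'` answered by the description at `1…1 0 x'` of the input's length.
[cite: MurrayWilliams2018, Thm. 2.2 (SIAM J. Comput. 49, Thm. 2.7)] [cite: Santhanam2009, Lemma 12] -/
def _root_.Literature.Computability.Complexity.AlmostAE.SameLengthChecker.ofDownwardFn (S : Language Bool)
    (C : DownwardCheckerFn S) : AlmostAE.SameLengthChecker (onesZeroPad S) where
  lang := ChkF.lang C
  mem_P := ChkF.lang_mem_P C
  coins := C.coins
  complete ℓ d hd z hz hzℓ r hr := ChkF.complete C ℓ d hd z hz hzℓ r hr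
  sound z hz d := ChkF.sound C z hz d

end OnesZeroPad

/-- **Murray–Williams' Theorem 2.2, the language, from a description-form downward checker**: a
`PSPACE`-hard `S` with a downward self-reduction machine of IW's Def. 6 form and a `DownwardCheckerFn`
yields the five clauses of Thm. 2.2 for `onesZeroPad S`. [cite: MurrayWilliams2018, Thm. 2.2 (SIAM Thm. 2.7)] -/
theorem MurrayWilliams2018_thm_2_2_language_of_downwardFn (S : Language Bool) (hhard : IsHard PSPACE S)
    (A₀ : OracleAlg (List Bool)) (hA₀ : A₀.IsPolyTime (encodingList Bool)) (bA : Polynomial ℕ)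
    (hdsr : ∀ (x : List Bool) (O : Oracle), (∀ y : List Bool, y.length < x.length → O y = Oracle.ofLanguage S y) →
      A₀.run O (bA.eval x.length) x = some (Oracle.ofLanguage S x))
    (C : DownwardCheckerFn S) :
    ∃ L : Language Bool, IsHard PSPACE L ∧ (∀ x : List Bool, true :: x ∈ L ↔ x ∈ L) ∧
      (∀ n : ℕ, List.replicate n true ∉ L) ∧ Nonempty (AlmostAE.DSR L) ∧ Nonempty (AlmostAE.SameLengthChecker L) :=
  ⟨onesZeroPad S, OnesZeroPad.isHard hhard, OnesZeroPad.true_cons_mem_iff, OnesZeroPad.replicate_not_mem,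
    ⟨AlmostAE.DSR.ofOnesZeroPad S A₀ hA₀ bA hdsr⟩, ⟨AlmostAE.SameLengthChecker.ofDownwardFn S C⟩⟩

/-- **The headline `NQP ⊄ ACC⁰` from a `PSPACE`-hard `S` with a downward self-reduction machine and a
description-form downward checker** — nothing else. [cite: MurrayWilliams2018, §1.1, Thm. 2.2, Thm. 3.1, Lemma 4.1, Thm. 1.3] -/
theorem MurrayWilliams2018_NQP_not_subset_ACC0_of_downwardFn (S : Language Bool) (hhard : IsHard PSPACE S)
    (A₀ : OracleAlg (List Bool)) (hA₀ : A₀.IsPolyTime (encodingList Bool)) (bA : Polynomial ℕ)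
    (hdsr : ∀ (x : List Bool) (O : Oracle), (∀ y : List Bool, y.length < x.length → O y = Oracle.ofLanguage S y) →
      A₀.run O (bA.eval x.length) x = some (Oracle.ofLanguage S x))
    (C : DownwardCheckerFn S) : MurrayWilliams2018_NQP_not_subset_ACC0 :=
  MurrayWilliams2018_NQP_not_subset_ACC0_of_exists_thm_2_2_language
    (MurrayWilliams2018_thm_2_2_language_of_downwardFn S hhard A₀ hA₀ bA hdsr C)

/-- **Lemma 4.1 (a.e. form) from the same data and a generator of Umans' type.**
[cite: MurrayWilliams2018, Lemma 4.1, Thm. 2.1, Thm. 2.2, Thm. 3.1] -/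
theorem MurrayWilliams2018_lemma_4_1_ae_of_downwardFn_of_umansGenerator (S : Language Bool) (hhard : IsHard PSPACE S)
    (A₀ : OracleAlg (List Bool)) (hA₀ : A₀.IsPolyTime (encodingList Bool)) (bA : Polynomial ℕ)
    (hdsr : ∀ (x : List Bool) (O : Oracle), (∀ y : List Bool, y.length < x.length → O y = Oracle.ofLanguage S y) →
      A₀.run O (bA.eval x.length) x = some (Oracle.ofLanguage S x))
    (C : DownwardCheckerFn S) (G : UmansGenerator) : MurrayWilliams2018_lemma_4_1_ae :=
  MurrayWilliams2018_lemma_4_1_ae_of_sameLengthChecker_of_umansGenerator (onesZeroPad S)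
    (OnesZeroPad.isHard hhard) OnesZeroPad.true_cons_mem_iff OnesZeroPad.replicate_not_mem
    (AlmostAE.DSR.ofOnesZeroPad S A₀ hA₀ bA hdsr) (AlmostAE.SameLengthChecker.ofDownwardFn S C) G

end Literature.Computability.Complexity

end
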